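import Summits.Ventures.PercRepro.C026GluingDefs

/-!
# Transport of the D-free inequality along a support-injective graph map (p6, gen 8)

The every-`p` corollary of the composition theorem (mine-3 §26.8 «faces of a gluing are gluings of
faces») compares the PART of a marked minor of a gluing with the marked MINOR of the part: the two
graphs have the same edges (an `Equiv` of edge types) and a vertex map (the part's sure classes to the
gluing's sure classes) that is injective on the vertices that matter — the vertices incident to an
edge, and the marks — but may identify isolated vertices with anything.  This file proves that the
D-free inequality passes along such a map:

* `Supp A a b c x` — `x` is incident to an edge of `A`, or a mark;
* a **support-injective map** `(ε, φ)`: `ε : EA ≃ EB`, `B.fst (ε e) = φ (A.fst e)`,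
  `B.snd (ε e) = φ (A.snd e)`, `φ` injective on `Supp`; configurations of `B` pull back along `ε`
  (`pullConfig`), a bijection (`pullEquiv`);
* connectivity, clusters, `IsBot`, H-steps and H-walks between vertices of the support correspond
  (`conn_map_iff`, `mem_cluster_map_iff`, `isBot_map_iff`, `hAdj_map_iff`, `hConnAvoid_map_iff`,
  `hConn_map_iff`) — an H-walk from a mark never leaves the support (`hAdj_supp`, `hAdj_supp_map`);
* **`dFreeIneq_map`**: `A.DFreeIneq a b c → B.DFreeIneq (φ a) (φ b) (φ c)`.
-/

namespace PercRepro

namespace MultiGraph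

section Transport

variable {VA EA VB EB : Type*}

/-- The vertices of `A` that matter for the three marks: incident to an edge, or a mark. -/
def Supp (A : MultiGraph VA EA) (a b c : VA) (x : VA) : Prop :=
  (∃ e, A.EdgeAt e x) ∨ x = a ∨ x = b ∨ x = c

/-- The pull-back of a configuration of `B` along an edge equivalence. -/
def pullConfig (ε : EA ≃ EB) (ω : Config EB) : Config EA := fun e => ω (ε e)

/-- Pull-back is a bijection of configuration spaces. -/
def pullEquiv (ε : EA ≃ EB) : Config EB ≃ Config EA where
  toFun := pullConfig ε
  invFun ω e := ω (ε.symm e)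
  left_inv ω := by
    funext f
    simp [pullConfig]
  right_inv ω := by
    funext e
    simp [pullConfig]

/-- Pull-back evaluates along `ε`. -/
@[simp] theorem pullConfig_apply (ε : EA ≃ EB) (ω : Config EB) (e : EA) :
    pullConfig ε ω e = ω (ε e) := rfl

/-- The bijection is the pull-back. -/
@[simp] theorem pullEquiv_apply (ε : EA ≃ EB) (ω : Config EB) :
    pullEquiv ε ω = pullConfig ε ω := rfl

variable {A : MultiGraph VA EA} {B : MultiGraph VB EB} {ε : EA ≃ EB} {φ : VA → VB} {a b c : VA}

/-- A mark is in the support. -/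
theorem supp_mark {x : VA} (h : x = a ∨ x = b ∨ x = c) : A.Supp a b c x := Or.inr h

/-- A vertex of an edge is in the support. -/
theorem supp_of_edgeAt {e : EA} {x : VA} (h : A.EdgeAt e x) : A.Supp a b c x := Or.inl ⟨e, h⟩

/-- The endpoint of a nontrivial path is in the support. -/
theorem supp_of_conn {ω : Config EA} {x y : VA} (h : A.Conn ω x y) (hne : y ≠ x) :
    A.Supp a b c y := by
  rcases Relation.ReflTransGen.cases_tail h with h | ⟨_, _, hzy⟩
  · exact absurd h hne
  · obtain ⟨e, _, hend⟩ := hzy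
    exact supp_of_edgeAt (EdgeAt.of_joins_right (hend : A.Joins e _ y))

/-- The target of an H-step from a vertex of the support is in the support. -/
theorem hAdj_supp {ω : Config EA} {x y : VA} (hx : A.Supp a b c x) (h : A.HAdj ω c x y) :
    A.Supp a b c y := by
  rcases h with ⟨_, _, e, _, hj⟩ | ⟨_, e, hj⟩ | ⟨_, _, hc⟩
  · exact supp_of_edgeAt (EdgeAt.of_joins_right hj)
  · exact supp_of_edgeAt (EdgeAt.of_joins_right hj)
  · by_cases hxy : x = y
    · exact hxy ▸ hx
    · exact supp_of_conn hc (Ne.symm hxy)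

variable (hfst : ∀ e, B.fst (ε e) = φ (A.fst e)) (hsnd : ∀ e, B.snd (ε e) = φ (A.snd e))
  (hinj : ∀ x y, A.Supp a b c x → A.Supp a b c y → φ x = φ y → x = y)

include hfst hsnd in
/-- `Joins` maps forward. -/
theorem joins_map {e : EA} {x y : VA} (h : A.Joins e x y) : B.Joins (ε e) (φ x) (φ y) := by
  rcases h with ⟨h1, h2⟩ | ⟨h1, h2⟩
  · exact Or.inl ⟨by rw [hfst, h1], by rw [hsnd, h2]⟩
  · exact Or.inr ⟨by rw [hfst, h1], by rw [hsnd, h2]⟩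

include hfst hsnd hinj in
/-- `Joins` lifts between vertices of the support. -/
theorem joins_of_map {e : EA} {x y : VA} (hx : A.Supp a b c x) (hy : A.Supp a b c y)
    (h : B.Joins (ε e) (φ x) (φ y)) : A.Joins e x y := by
  rcases h with ⟨h1, h2⟩ | ⟨h1, h2⟩
  · rw [hfst] at h1
    rw [hsnd] at h2
    exact Or.inl ⟨hinj _ _ (supp_of_edgeAt (Or.inl rfl)) hx h1,
      hinj _ _ (supp_of_edgeAt (Or.inr rfl)) hy h2⟩
  · rw [hfst] at h1
    rw [hsnd] at h2
    exact Or.inr ⟨hinj _ _ (supp_of_edgeAt (Or.inl rfl)) hy h1,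
      hinj _ _ (supp_of_edgeAt (Or.inr rfl)) hx h2⟩

include hfst hsnd in
/-- Connectivity maps forward. -/
theorem conn_map {ω : Config EB} {x y : VA} (h : A.Conn (pullConfig ε ω) x y) :
    B.Conn ω (φ x) (φ y) := by
  unfold Conn at h ⊢
  induction h with
  | refl => exact Relation.ReflTransGen.refl
  | tail _ hxy ih =>
    obtain ⟨e, he, hend⟩ := hxy
    exact ih.tail ⟨ε e, he, joins_map hfst hsnd (hend : A.Joins e _ _)⟩

include hfst hsnd hinj in
/-- Connectivity lifts from a vertex of the support: every vertex reached in `B` from `φ x` is the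
image of a vertex of the support reached in `A` from `x`. -/
theorem exists_conn_of_map {ω : Config EB} {x : VA} (hx : A.Supp a b c x) {w : VB}
    (h : B.Conn ω (φ x) w) : ∃ y, A.Supp a b c y ∧ φ y = w ∧ A.Conn (pullConfig ε ω) x y := by
  refine Conn.induction (motive := fun w => ∃ y, A.Supp a b c y ∧ φ y = w ∧
    A.Conn (pullConfig ε ω) x y) ⟨x, hx, rfl, Conn.refl _ _ _⟩ ?_ h
  intro w w' _ hww' hw
  obtain ⟨y, hy, rfl, hxy⟩ := hw
  obtain ⟨f, hf, hend⟩ := hww'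
  obtain ⟨e, rfl⟩ := ε.surjective f
  have hend' : B.Joins (ε e) (φ y) w' := hend
  rcases hend' with ⟨h1, h2⟩ | ⟨h1, h2⟩
  · rw [hfst] at h1
    have h1' : A.fst e = y := hinj _ _ (supp_of_edgeAt (Or.inl rfl)) hy h1
    refine ⟨A.snd e, supp_of_edgeAt (Or.inr rfl), by rw [← h2, hsnd], hxy.tail ⟨e, hf, ?_⟩⟩
    exact Or.inl ⟨h1', rfl⟩
  · rw [hsnd] at h2
    have h2' : A.snd e = y := hinj _ _ (supp_of_edgeAt (Or.inr rfl)) hy h2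
    refine ⟨A.fst e, supp_of_edgeAt (Or.inl rfl), by rw [← h1, hfst], hxy.tail ⟨e, hf, ?_⟩⟩
    exact Or.inr ⟨rfl, h2'⟩

include hfst hsnd hinj in
/-- **Connectivity corresponds** between vertices of the support. -/
theorem conn_map_iff {ω : Config EB} {x y : VA} (hx : A.Supp a b c x) (hy : A.Supp a b c y) :
    A.Conn (pullConfig ε ω) x y ↔ B.Conn ω (φ x) (φ y) := by
  constructor
  · exact conn_map hfst hsnd
  · intro h
    obtain ⟨y', hy', hyy', hxy'⟩ := exists_conn_of_map hfst hsnd hinj hx h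
    rw [hinj _ _ hy' hy hyy'] at hxy'
    exact hxy'

include hfst hsnd hinj in
/-- Cluster membership corresponds between vertices of the support. -/
theorem mem_cluster_map_iff {ω : Config EB} {x y : VA} (hx : A.Supp a b c x)
    (hy : A.Supp a b c y) :
    y ∈ A.cluster (pullConfig ε ω) x ↔ φ y ∈ B.cluster ω (φ x) :=
  conn_map_iff hfst hsnd hinj hx hy

include hfst hsnd hinj in
/-- `IsBot` corresponds. -/
theorem isBot_map_iff (ω : Config EB) :
    A.IsBot (pullConfig ε ω) a b c ↔ B.IsBot ω (φ a) (φ b) (φ c) := by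
  unfold IsBot
  rw [conn_map_iff hfst hsnd hinj (supp_mark (Or.inl rfl)) (supp_mark (Or.inr (Or.inl rfl))),
    conn_map_iff hfst hsnd hinj (supp_mark (Or.inl rfl)) (supp_mark (Or.inr (Or.inr rfl))),
    conn_map_iff hfst hsnd hinj (supp_mark (Or.inr (Or.inl rfl))) (supp_mark (Or.inr (Or.inr rfl)))]

include hfst hsnd hinj in
/-- **H-steps correspond** between vertices of the support (the centre `c` is a mark). -/
theorem hAdj_map_iff {ω : Config EB} {x y : VA} (hx : A.Supp a b c x) (hy : A.Supp a b c y) :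
    A.HAdj (pullConfig ε ω) c x y ↔ B.HAdj ω (φ c) (φ x) (φ y) := by
  have hc : A.Supp a b c c := supp_mark (Or.inr (Or.inr rfl))
  have hxM := mem_cluster_map_iff hfst hsnd hinj (ω := ω) hc hx
  have hyM := mem_cluster_map_iff hfst hsnd hinj (ω := ω) hc hy
  have hedge : (∃ e, pullConfig ε ω e = false ∧ A.Joins e x y) ↔
      ∃ f, ω f = false ∧ B.Joins f (φ x) (φ y) := by
    constructor
    · rintro ⟨e, he, hj⟩
      exact ⟨ε e, he, joins_map hfst hsnd hj⟩
    · rintro ⟨f, hf, hj⟩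
      obtain ⟨e, rfl⟩ := ε.surjective f
      exact ⟨e, hf, joins_of_map hfst hsnd hinj hx hy hj⟩
  have hedge' : (∃ e, A.Joins e x y) ↔ ∃ f, B.Joins f (φ x) (φ y) := by
    constructor
    · rintro ⟨e, hj⟩
      exact ⟨ε e, joins_map hfst hsnd hj⟩
    · rintro ⟨f, hj⟩
      obtain ⟨e, rfl⟩ := ε.surjective f
      exact ⟨e, joins_of_map hfst hsnd hinj hx hy hj⟩
  unfold HAdj
  rw [hxM, hyM, hedge, hedge', conn_map_iff hfst hsnd hinj hx hy]

include hfst hsnd hinj in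
/-- The target of an H-step of `B` from the image of a support vertex is the image of a support
vertex. -/
theorem hAdj_supp_map {ω : Config EB} {x : VA} (hx : A.Supp a b c x) {w : VB}
    (h : B.HAdj ω (φ c) (φ x) w) : ∃ y, A.Supp a b c y ∧ φ y = w := by
  rcases h with ⟨_, _, f, _, hj⟩ | ⟨_, f, hj⟩ | ⟨_, _, hc⟩
  · obtain ⟨e, rfl⟩ := ε.surjective f
    rcases hj with ⟨_, h2⟩ | ⟨h1, _⟩
    · exact ⟨A.snd e, supp_of_edgeAt (Or.inr rfl), by rw [← h2, hsnd]⟩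
    · exact ⟨A.fst e, supp_of_edgeAt (Or.inl rfl), by rw [← h1, hfst]⟩
  · obtain ⟨e, rfl⟩ := ε.surjective f
    rcases hj with ⟨_, h2⟩ | ⟨h1, _⟩
    · exact ⟨A.snd e, supp_of_edgeAt (Or.inr rfl), by rw [← h2, hsnd]⟩
    · exact ⟨A.fst e, supp_of_edgeAt (Or.inl rfl), by rw [← h1, hfst]⟩
  · obtain ⟨y, hy, hyw, _⟩ := exists_conn_of_map hfst hsnd hinj hx hc
    exact ⟨y, hy, hyw⟩

include hfst hsnd hinj in
/-- **Avoiding H-walks correspond** between vertices of the support, the avoidance sets being the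
clusters of a mark `m`. -/
theorem hConnAvoid_map_iff {ω : Config EB} {m x y : VA} (hm : m = a ∨ m = b ∨ m = c)
    (hx : A.Supp a b c x) (hy : A.Supp a b c y) :
    A.HConnAvoid (pullConfig ε ω) c (A.cluster (pullConfig ε ω) m) x y ↔
      B.HConnAvoid ω (φ c) (B.cluster ω (φ m)) (φ x) (φ y) := by
  have hmS : A.Supp a b c m := supp_mark hm
  constructor
  · intro h
    unfold HConnAvoid at h ⊢
    -- the walk stays in the support; map it step by step
    suffices key : ∀ z, Relation.ReflTransGen (fun x y => A.HAdj (pullConfig ε ω) c x y ∧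
        x ∉ A.cluster (pullConfig ε ω) m ∧ y ∉ A.cluster (pullConfig ε ω) m) x z →
        A.Supp a b c z ∧ Relation.ReflTransGen (fun x y => B.HAdj ω (φ c) x y ∧
          x ∉ B.cluster ω (φ m) ∧ y ∉ B.cluster ω (φ m)) (φ x) (φ z) from (key y h).2
    intro z hz
    induction hz with
    | refl => exact ⟨hx, Relation.ReflTransGen.refl⟩
    | @tail z z' _ hzz' ih =>
      obtain ⟨hadj, hzL, hz'L⟩ := hzz'
      obtain ⟨hzS, hwalk⟩ := ih
      have hz'S : A.Supp a b c z' := hAdj_supp hzS hadj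
      refine ⟨hz'S, hwalk.tail ⟨(hAdj_map_iff hfst hsnd hinj hzS hz'S).mp hadj, ?_, ?_⟩⟩
      · exact fun h => hzL ((mem_cluster_map_iff hfst hsnd hinj hmS hzS).mpr h)
      · exact fun h => hz'L ((mem_cluster_map_iff hfst hsnd hinj hmS hz'S).mpr h)
  · intro h
    unfold HConnAvoid at h ⊢
    suffices key : ∀ w, Relation.ReflTransGen (fun x y => B.HAdj ω (φ c) x y ∧
        x ∉ B.cluster ω (φ m) ∧ y ∉ B.cluster ω (φ m)) (φ x) w →
        ∃ z, A.Supp a b c z ∧ φ z = w ∧ Relation.ReflTransGen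
          (fun x y => A.HAdj (pullConfig ε ω) c x y ∧
            x ∉ A.cluster (pullConfig ε ω) m ∧ y ∉ A.cluster (pullConfig ε ω) m) x z by
      obtain ⟨z, hzS, hzy, hwalk⟩ := key _ h
      rw [hinj _ _ hzS hy hzy] at hwalk
      exact hwalk
    intro w hw
    induction hw with
    | refl => exact ⟨x, hx, rfl, Relation.ReflTransGen.refl⟩
    | @tail w w' _ hww' ih =>
      obtain ⟨hadj, hwL, hw'L⟩ := hww'
      obtain ⟨z, hzS, rfl, hwalk⟩ := ih
      obtain ⟨z', hz'S, rfl⟩ := hAdj_supp_map hfst hsnd hinj hzS hadj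
      refine ⟨z', hz'S, rfl, hwalk.tail ⟨(hAdj_map_iff hfst hsnd hinj hzS hz'S).mpr hadj, ?_, ?_⟩⟩
      · exact fun h => hwL ((mem_cluster_map_iff hfst hsnd hinj hmS hzS).mp h)
      · exact fun h => hw'L ((mem_cluster_map_iff hfst hsnd hinj hmS hz'S).mp h)

include hfst hsnd hinj in
/-- **H-walks correspond** between vertices of the support. -/
theorem hConn_map_iff {ω : Config EB} {x y : VA} (hx : A.Supp a b c x) (hy : A.Supp a b c y) :
    A.HConn (pullConfig ε ω) c x y ↔ B.HConn ω (φ c) (φ x) (φ y) := by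
  constructor
  · intro h
    unfold HConn at h ⊢
    suffices key : ∀ z, Relation.ReflTransGen (A.HAdj (pullConfig ε ω) c) x z →
        A.Supp a b c z ∧ Relation.ReflTransGen (B.HAdj ω (φ c)) (φ x) (φ z) from (key y h).2
    intro z hz
    induction hz with
    | refl => exact ⟨hx, Relation.ReflTransGen.refl⟩
    | @tail z z' _ hzz' ih =>
      obtain ⟨hzS, hwalk⟩ := ih
      have hz'S : A.Supp a b c z' := hAdj_supp hzS hzz'
      exact ⟨hz'S, hwalk.tail ((hAdj_map_iff hfst hsnd hinj hzS hz'S).mp hzz')⟩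
  · intro h
    unfold HConn at h ⊢
    suffices key : ∀ w, Relation.ReflTransGen (B.HAdj ω (φ c)) (φ x) w →
        ∃ z, A.Supp a b c z ∧ φ z = w ∧
          Relation.ReflTransGen (A.HAdj (pullConfig ε ω) c) x z by
      obtain ⟨z, hzS, hzy, hwalk⟩ := key _ h
      rw [hinj _ _ hzS hy hzy] at hwalk
      exact hwalk
    intro w hw
    induction hw with
    | refl => exact ⟨x, hx, rfl, Relation.ReflTransGen.refl⟩
    | @tail w w' _ hww' ih =>
      obtain ⟨z, hzS, rfl, hwalk⟩ := ih
      obtain ⟨z', hz'S, rfl⟩ := hAdj_supp_map hfst hsnd hinj hzS hww'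
      exact ⟨z', hz'S, rfl, hwalk.tail ((hAdj_map_iff hfst hsnd hinj hzS hz'S).mpr hww')⟩

variable [Fintype EA] [DecidableEq EA] [Fintype EB] [DecidableEq EB]

open Classical in
include hfst hsnd hinj in
/-- **The D-free inequality transports** along a support-injective map. -/
theorem dFreeIneq_map (h : A.DFreeIneq a b c) : B.DFreeIneq (φ a) (φ b) (φ c) := by
  rw [dFreeIneq_iff_hGraph] at h ⊢
  have ha : A.Supp a b c a := supp_mark (Or.inl rfl)
  have hb : A.Supp a b c b := supp_mark (Or.inr (Or.inl rfl))
  have hc : A.Supp a b c c := supp_mark (Or.inr (Or.inr rfl))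
  have e1 : (Finset.univ.filter fun ω : Config EB =>
      B.IsBot ω (φ a) (φ b) (φ c) ∧ B.HConn ω (φ c) (φ a) (φ b)).card =
      (Finset.univ.filter fun ω : Config EA => A.IsBot ω a b c ∧ A.HConn ω c a b).card := by
    refine Finset.card_equiv (pullEquiv ε) fun ω => ?_
    simp only [Finset.mem_filter, Finset.mem_univ, true_and, pullEquiv_apply]
    rw [isBot_map_iff hfst hsnd hinj ω, hConn_map_iff hfst hsnd hinj ha hb]
  have e2 : (Finset.univ.filter fun ω : Config EB =>
      B.IsBot ω (φ a) (φ b) (φ c) ∧ B.HConnAvoid ω (φ c) (B.cluster ω (φ b)) (φ c) (φ a)).card =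
      (Finset.univ.filter fun ω : Config EA =>
        A.IsBot ω a b c ∧ A.HConnAvoid ω c (A.cluster ω b) c a).card := by
    refine Finset.card_equiv (pullEquiv ε) fun ω => ?_
    simp only [Finset.mem_filter, Finset.mem_univ, true_and, pullEquiv_apply]
    rw [isBot_map_iff hfst hsnd hinj ω, hConnAvoid_map_iff hfst hsnd hinj (Or.inr (Or.inl rfl)) hc ha]
  have e3 : (Finset.univ.filter fun ω : Config EB =>
      B.IsBot ω (φ a) (φ b) (φ c) ∧ B.HConnAvoid ω (φ c) (B.cluster ω (φ a)) (φ c) (φ b)).card =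
      (Finset.univ.filter fun ω : Config EA =>
        A.IsBot ω a b c ∧ A.HConnAvoid ω c (A.cluster ω a) c b).card := by
    refine Finset.card_equiv (pullEquiv ε) fun ω => ?_
    simp only [Finset.mem_filter, Finset.mem_univ, true_and, pullEquiv_apply]
    rw [isBot_map_iff hfst hsnd hinj ω, hConnAvoid_map_iff hfst hsnd hinj (Or.inl rfl) hc hb]
  rw [e1, e2, e3]
  exact h

end Transport

end MultiGraph

end PercRepro
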